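import Mathlib
import Summits.QuantumFields.QCD.Theorems.SpectralDefectExtinctionExtinctionBuildsQCDStubWindowModesLocalisedAux
import Summits.QuantumFields.QCD.Theorems.SpectralDefectExtinctionExtinctionBuildsQCDStubWindowModesLocalisedAux4

/-!
# Localisation of window modes from a patch system (support for stub `stub_windowModesLocalised`)
(line `block-away-the-sign`, crux `Summit.QuantumFields.QCD.Theses.SpectralDefectExtinction.ExtinctionBuildsQCD`,
item stmt-QuantumFields-18064)

`stub_windowModesLocalisedAux5` — the ASSEMBLY of the sparse-window-wells argument for the Hermitian Wilson–Dirac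
matrix `H = Γ₅ D_W(U, m₀, 1)` (`SU(3)`, torus `(ℤ/L)⁴`), for an arbitrary PATCH SYSTEM on the sites (partition
functions `χ_J` with `Σ_J χ_J² = 1` and one-step Lipschitz constant `Σ_J (χ_J(x+e_μ) − χ_J(x))² ≤ D`, enlarged
boxes `B⁺_J ⊇ supp χ_J` of size `≤ Bmax`, a reflexive symmetric closeness relation with `≤ M` close patches and
boxes of non-close patches `3`-separated) and levels `0 ≤ E₀ < E₂ ≤ 1`, `0 < E₁` with the numerical gap
`D (96 + 96²) ≤ E₁² − E₂²`, GIVEN the min–max well budget (W1) and the abstract Agmon estimate (W2) as hypotheses: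
with `R :=` the union of the boxes of the BAD patches (those carrying a strict quasi-mode below `E₁`),
(i) `|R| ≤ M · Bmax · #{eigenvalues in (−E₁, E₁)}` (budget, `…Aux4`); (ii) IMS localisation (`…Aux`) gives the
OUTER FLOOR `E₂² ‖v‖² ≤ ‖Hv‖²` for `v` vanishing over `R`, hence `(E₂ − E₀)² ‖v‖² ≤ ‖(H − λ)v‖²` for `|λ| ≤ E₀`;
(iii) W2 with `ρ = dist(·, R)`, `r₀ = 1`, `κ = (E₂ − E₀)/768` (`96(e^κ − 1) ≤ (E₂ − E₀)/4`) gives the decay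
`Σ_{dist(p,R) ≥ d} ‖ψ_p‖² ≤ 300 e^{−(E₂−E₀) d/384} ‖ψ‖²` of every eigenvector with `|λ| ≤ E₀`.

References (prose): Cycon–Froese–Kirsch–Simon (1987) §3.1; Agmon (1982); Combes–Thomas (1973).
-/

noncomputable section

namespace Summit.QuantumFields.QCD.Cruxes.ExtinctionBuildsQCD.BlockAwayTheSign

open scoped BigOperators Classical Matrix
open Matrix Finset
open Literature.MathematicalPhysics.QuantumLattice Literature.MathematicalPhysics.QuantumFieldTheory
  Literature.Probability.LatticeModels
open Literature.Barriers.QuantumFields.WilsonDeterminant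

namespace WindowModes

/-- **Helper W3-Aux5 (`stub_windowModesLocalisedAux5`) — localisation of window modes of `Γ₅ D_W` from a patch
system, given the well budget (W1) and the abstract Agmon estimate (W2).** -/
theorem stub_windowModesLocalisedAux5 : (∀ {ι : Type} [Fintype ι] [DecidableEq ι] {H : Matrix ι ι ℂ}, H.IsHermitian → ∀ (E : ℝ), 0 < E → ∀ {k : ℕ} (φ : Fin k → ι → ℂ), (∀ a b, a ≠ b → ∀ i, φ a i = 0 ∨ φ b i = 0) → (∀ a b, a ≠ b → star (H *ᵥ φ a) ⬝ᵥ (H *ᵥ φ b) = 0) → (∀ a, ∑ i, ‖(H *ᵥ φ a) i‖ ^ 2 < E ^ 2 * ∑ i, ‖φ a i‖ ^ 2) → k ≤ H.charpoly.roots.countP (fun z => |z.re| < E)) → (∀ {ι : Type} [Fintype ι] [DecidableEq ι] (dist : ι → ι → ℕ), (∀ i, dist i i = 0) → (∀ i j, dist i j = dist j i) → (∀ i j l, dist i l ≤ dist i j + dist j l) → ∀ (A : Matrix ι ι ℂ), (∀ i j, A i j ≠ 0 → dist i j ≤ 1) → ∀ (h : ℝ), (∀ i, ∑ j ∈ Finset.univ.filter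 (fun j => dist i j ≠ 0), ‖A i j‖ ≤ h) → (∀ j, ∑ i ∈ Finset.univ.filter (fun i => dist i j ≠ 0), ‖A i j‖ ≤ h) → ∀ (ρ : ι → ℕ), (∀ i j, (ρ i : ℤ) - ρ j ≤ dist i j) → ∀ (E₀ g : ℝ), 0 < g → ∀ (r₀ : ℕ), (∀ lam : ℝ, |lam| ≤ E₀ → ∀ v : ι → ℂ, (∀ i, ρ i < r₀ → v i = 0) → g ^ 2 * ∑ i, ‖v i‖ ^ 2 ≤ ∑ i, ‖((A - (lam : ℂ) • (1 : Matrix ι ι ℂ)) *ᵥ v) i‖ ^ 2) → ∀ (κ : ℝ), 0 ≤ κ → h * (Real.exp κ - 1) ≤ g / 4 → ∀ (lam : ℝ) (ψ : ι → ℂ), |lam| ≤ E₀ → A *ᵥ ψ = (lam : ℂ) • ψ → ∀ d : ℕ, ∑ i ∈ Finset.univ.filter (fun i => r₀ + d ≤ ρ i), ‖ψ i‖ ^ 2 ≤ 100 * Real.exp (-(2 * κ * (d : ℝ))) * ∑ i, ‖ψ i‖ ^ 2) → ∀ {L : ℕ} [NeZero L] (U : GaugeConfig 4 L SU3) (m₀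 : ℝ) {𝒥 : Type} [Fintype 𝒥] (χ : 𝒥 → TorusSite 4 L → ℝ) (Bplus : 𝒥 → Finset (TorusSite 4 L)) (Close : 𝒥 → 𝒥 → Prop) (M Bmax : ℕ) (D : ℝ), 0 ≤ D → (∀ x, ∑ J, χ J x ^ 2 = 1) → (∀ J x, χ J x ≠ 0 → x ∈ Bplus J) → (∀ (x : TorusSite 4 L) (μ : Fin 4), ∑ J, (χ J (x + Pi.single μ 1) - χ J x) ^ 2 ≤ D) → (∀ J, Close J J) → (∀ J J', Close J J' → Close J' J) → (∀ J J', ¬ Close J J' → ∀ x ∈ Bplus J, ∀ y ∈ Bplus J', 3 ≤ torusTaxiDist x y) → (∀ J, (Finset.univ.filter (Close J)).card ≤ M) → (∀ J, (Bplus J).card ≤ Bmax) → ∀ (E₁ E₂ E₀ : ℝ), 0 < E₁ → 0 ≤ E₀ → E₀ < E₂ → E₂ ≤ 1 → D * (96 + 96 ^ 2) ≤ E₁ ^ 2 - E₂ ^ 2 → ∃ R : Finset (TorusSite 4 L), R.card ≤ M * Bmax * (hermitianWilsonDirac (fundamentalRep (Fin 3)) U m₀ 1).charpoly.roots.countP (fun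 z => |z.re| < E₁) ∧ ∀ (lam : ℝ) (ψ : Idx L 3 → ℂ), |lam| ≤ E₀ → hermitianWilsonDirac (fundamentalRep (Fin 3)) U m₀ 1 *ᵥ ψ = (lam : ℂ) • ψ → ∀ d : ℕ, ∑ p ∈ Finset.univ.filter (fun p : Idx L 3 => ∀ x ∈ R, d ≤ torusTaxiDist p.1 x), ‖ψ p‖ ^ 2 ≤ 300 * Real.exp (-((E₂ - E₀) / 384 * d)) * ∑ p, ‖ψ p‖ ^ 2 := by
  intro hW1 hW2 L _ U m₀ 𝒥 _ χ Bplus Close M Bmax D hD hχ1 hχB hχD hrefl hsymm hsep hM hBmax E₁ E₂ E₀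
    hE₁ hE₀ hE₀₂ hE₂ hgap
  obtain ⟨hHerm, hrange, hadj, hrow, hcol, htaxi0⟩ := hW_geometry U m₀
  set H := hermitianWilsonDirac (fundamentalRep (Fin 3)) U m₀ 1 with hHdef
  -- the bad patches and their budget
  set Bad : Finset 𝒥 := univ.filter fun J => ∃ φ : Idx L 3 → ℂ, (∀ p, p.1 ∉ Bplus J → φ p = 0) ∧
    ∑ p, ‖(H *ᵥ φ) p‖ ^ 2 < E₁ ^ 2 * ∑ p, ‖φ p‖ ^ 2 with hBad
  have hbudget : Bad.card ≤ M * H.charpoly.roots.countP (fun z => |z.re| < E₁) :=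
    stub_windowModesLocalisedAux4 hW1 (site := (Prod.fst : Idx L 3 → TorusSite 4 L))
      (fun x y : TorusSite 4 L => torusTaxiDist x y) (fun x => torusTaxiDist_self x)
      (fun x y => torusTaxiDist_comm x y) (fun x y z => torusDistOne_triangle (Ls := fun _ : Fin 4 => L) x y z)
      hHerm hrange Bplus Close hrefl hsymm hsep M hM E₁ hE₁
  -- the well set
  set R : Finset (TorusSite 4 L) := Bad.biUnion Bplus with hR
  refine ⟨R, ?_, ?_⟩
  · calc R.card ≤ ∑ J ∈ Bad, (Bplus J).card := card_biUnion_le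
      _ ≤ ∑ _J ∈ Bad, Bmax := sum_le_sum fun J _ => hBmax J
      _ = Bad.card * Bmax := by rw [sum_const, smul_eq_mul]
      _ ≤ M * H.charpoly.roots.countP (fun z => |z.re| < E₁) * Bmax := Nat.mul_le_mul_right _ hbudget
      _ = _ := by ring
  -- (ii) the outer floor by IMS localisation
  have hfloor2 : ∀ v : Idx L 3 → ℂ, (∀ p, p.1 ∈ R → v p = 0) →
      E₂ ^ 2 * ∑ p, ‖v p‖ ^ 2 ≤ ∑ p, ‖(H *ᵥ v) p‖ ^ 2 := by
    intro v hv
    have hIMS := ims_partition_floor (fun p q : Idx L 3 => torusTaxiDist p.1 q.1) H 96 (by norm_num)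
      hrow hcol (fun J (p : Idx L 3) => χ J p.1) (fun p => hχ1 p.1) ?_ D hD ?_ E₁ v ?_
    · -- the algebra: `E₁² S ≤ (1 + 48 D) T + 9264 D S` and `9312 D ≤ E₁² − E₂²`, `E₂ ≤ 1` give `E₂² S ≤ T`
      set S := ∑ p, ‖v p‖ ^ 2 with hS
      set T := ∑ p, ‖(H *ᵥ v) p‖ ^ 2 with hT
      have hS0 : 0 ≤ S := Finset.sum_nonneg fun p _ => by positivity
      have hT0 : 0 ≤ T := Finset.sum_nonneg fun p _ => by positivity
      by_contra hlt
      push Not at hlt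
      have hE₂0 : 0 ≤ E₂ := hE₀.trans hE₀₂.le
      have hE₂1 : E₂ ^ 2 ≤ 1 := pow_le_one₀ hE₂0 hE₂
      have h1 : (1 + 48 * D) * T < (1 + 48 * D) * (E₂ ^ 2 * S) :=
        mul_lt_mul_of_pos_left hlt (by positivity)
      have h2 : D * (E₂ ^ 2 * S) ≤ D * S :=
        mul_le_mul_of_nonneg_left (by nlinarith) hD
      have h3 : D * (96 + 96 ^ 2) * S ≤ (E₁ ^ 2 - E₂ ^ 2) * S := mul_le_mul_of_nonneg_right hgap hS0
      linarith
    · -- `χ_J` is constant on `dist = 0` pairs (equal sites)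
      intro J p q _ h0
      rw [htaxi0 _ _ h0]
    · -- one-step Lipschitz bound on pairs joined by `H`
      intro p q hpq h0
      have hne : p.1 ≠ q.1 := fun h => h0 (by rw [h, torusTaxiDist_self])
      obtain ⟨μ, h | h⟩ := hadj p q hpq hne
      · rw [h]
        calc _ = ∑ J, (χ J (p.1 + Pi.single μ 1) - χ J p.1) ^ 2 :=
              Finset.sum_congr rfl fun J _ => by ring
          _ ≤ D := hχD p.1 μ
      · rw [h]; exact hχD q.1 μ
    · -- the local floors: bad patches carry no mass of `v`, good ones obey the floor by definition
      intro J
      by_cases hJ : J ∈ Bad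
      · have h0 : ∀ p : Idx L 3, (χ J p.1 : ℂ) * v p = 0 := by
          intro p
          by_cases hc : χ J p.1 = 0
          · rw [hc]; simp
          · rw [hv p (mem_biUnion.mpr ⟨J, hJ, hχB J p.1 hc⟩), mul_zero]
        have : ∑ p : Idx L 3, ‖(χ J p.1 : ℂ) * v p‖ ^ 2 = 0 :=
          Finset.sum_eq_zero fun p _ => by rw [h0 p]; simp
        rw [this, mul_zero]
        exact Finset.sum_nonneg fun p _ => by positivity
      · have hJ' : ¬ ∃ φ : Idx L 3 → ℂ, (∀ p, p.1 ∉ Bplus J → φ p = 0) ∧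
            ∑ p, ‖(H *ᵥ φ) p‖ ^ 2 < E₁ ^ 2 * ∑ p, ‖φ p‖ ^ 2 := fun h =>
          hJ (mem_filter.mpr ⟨mem_univ _, h⟩)
        push Not at hJ'
        exact hJ' _ fun p hp => by
          have : χ J p.1 = 0 := by by_contra hc; exact hp (hχB J p.1 hc)
          rw [this]; simp
  have hfloor : ∀ lam : ℝ, |lam| ≤ E₀ → ∀ v : Idx L 3 → ℂ, (∀ p, p.1 ∈ R → v p = 0) →
      (E₂ - E₀) ^ 2 * ∑ p, ‖v p‖ ^ 2 ≤ ∑ p, ‖((H - (lam : ℂ) • (1 : Matrix (Idx L 3) (Idx L 3) ℂ)) *ᵥ v) p‖ ^ 2 :=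
    fun lam hlam v hv => sq_floor_shift H E₂ E₀ hE₀₂.le v (hfloor2 v hv) lam hlam
  -- (iii) the decay
  intro lam ψ hlam heig d
  have hg : 0 < E₂ - E₀ := sub_pos.mpr hE₀₂
  have hS0 : 0 ≤ ∑ p, ‖ψ p‖ ^ 2 := Finset.sum_nonneg fun p _ => by positivity
  have hsub : ∑ p ∈ univ.filter (fun p : Idx L 3 => ∀ x ∈ R, d ≤ torusTaxiDist p.1 x), ‖ψ p‖ ^ 2 ≤
      ∑ p, ‖ψ p‖ ^ 2 :=
    Finset.sum_le_univ_sum_of_nonneg fun p => by positivity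
  have hexp0 : 0 < Real.exp (-((E₂ - E₀) / 384 * d)) := Real.exp_pos _
  by_cases hRe : R = ∅
  · -- no bad patch: the floor is global and kills every eigenvector with `|λ| ≤ E₀`
    have h0 := hfloor lam hlam ψ (fun p hp => by rw [hRe] at hp; simp at hp)
    have hz : (H - (lam : ℂ) • (1 : Matrix (Idx L 3) (Idx L 3) ℂ)) *ᵥ ψ = 0 := by
      rw [Matrix.sub_mulVec, Matrix.smul_mulVec, Matrix.one_mulVec, heig, sub_self]
    rw [hz] at h0
    simp only [Pi.zero_apply, norm_zero, ne_eq, OfNat.ofNat_ne_zero, not_false_eq_true, zero_pow,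
      Finset.sum_const_zero] at h0
    have hS : ∑ p, ‖ψ p‖ ^ 2 = 0 := le_antisymm (by nlinarith [pow_pos hg 2]) hS0
    calc _ ≤ ∑ p, ‖ψ p‖ ^ 2 := hsub
      _ = 0 := hS
      _ ≤ _ := by rw [hS, mul_zero]
  · have hne : R.Nonempty := nonempty_iff_ne_empty.mpr hRe
    set ρ : Idx L 3 → ℕ := fun p => R.inf' hne fun x => torusTaxiDist p.1 x with hρdef
    have hρ : ∀ p q : Idx L 3, (ρ p : ℤ) - ρ q ≤ torusTaxiDist p.1 q.1 := by
      intro p q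
      obtain ⟨x₀, hx₀, hq⟩ := Finset.exists_mem_eq_inf' hne fun x => torusTaxiDist q.1 x
      have h1 : ρ p ≤ torusTaxiDist p.1 x₀ := Finset.inf'_le _ hx₀
      have h2 := torusDistOne_triangle (Ls := fun _ : Fin 4 => L) p.1 q.1 x₀
      have h3 : ρ q = torusTaxiDist q.1 x₀ := hq
      have h4 : ρ p ≤ torusTaxiDist p.1 q.1 + ρ q := by rw [h3]; exact h1.trans h2
      omega
    have hfloorW2 : ∀ lam' : ℝ, |lam'| ≤ E₀ → ∀ v : Idx L 3 → ℂ, (∀ p, ρ p < 1 → v p = 0) →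
        (E₂ - E₀) ^ 2 * ∑ p, ‖v p‖ ^ 2 ≤
          ∑ p, ‖((H - (lam' : ℂ) • (1 : Matrix (Idx L 3) (Idx L 3) ℂ)) *ᵥ v) p‖ ^ 2 := by
      intro lam' hlam' v hv
      refine hfloor lam' hlam' v fun p hp => hv p ?_
      have : ρ p ≤ torusTaxiDist p.1 p.1 := Finset.inf'_le _ hp
      rw [torusTaxiDist_self] at this
      omega
    set κ : ℝ := (E₂ - E₀) / 768 with hκdef
    have hκ0 : 0 ≤ κ := by positivity
    have hκ1 : |κ| ≤ 1 := by rw [abs_of_nonneg hκ0, hκdef]; linarith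
    have hκh : 96 * (Real.exp κ - 1) ≤ (E₂ - E₀) / 4 := by
      have h1 := Real.abs_exp_sub_one_le hκ1
      rw [abs_of_nonneg hκ0, abs_of_nonneg (by linarith [Real.add_one_le_exp κ])] at h1
      rw [hκdef] at h1 ⊢
      linarith
    have hdec := hW2 (fun p q : Idx L 3 => torusTaxiDist p.1 q.1) (fun p => torusTaxiDist_self p.1)
      (fun p q => torusTaxiDist_comm p.1 q.1)
      (fun p q s => torusDistOne_triangle (Ls := fun _ : Fin 4 => L) p.1 q.1 s.1) H hrange 96 hrow hcol ρ hρ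
      E₀ (E₂ - E₀) hg 1 hfloorW2 κ hκ0 hκh lam ψ hlam heig
    rcases d with _ | d'
    · -- `d = 0`
      calc _ ≤ ∑ p, ‖ψ p‖ ^ 2 := hsub
        _ ≤ _ := by
          rw [Nat.cast_zero, mul_zero, neg_zero, Real.exp_zero, mul_one]
          linarith
    · have hfilter : univ.filter (fun p : Idx L 3 => ∀ x ∈ R, d' + 1 ≤ torusTaxiDist p.1 x) =
          univ.filter (fun p : Idx L 3 => 1 + d' ≤ ρ p) := by
        refine Finset.filter_congr fun p _ => ?_
        rw [add_comm 1 d', hρdef, Finset.le_inf'_iff]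
      have h1 := hdec d'
      rw [← hfilter] at h1
      refine h1.trans ?_
      -- `100 e^{−2κ d'} ≤ 300 e^{−(E₂−E₀)(d'+1)/384}` since `2κ = (E₂−E₀)/384 ≤ 1`
      have h2 : Real.exp (-(2 * κ * (d' : ℝ))) =
          Real.exp (2 * κ) * Real.exp (-((E₂ - E₀) / 384 * ((d' + 1 : ℕ) : ℝ))) := by
        rw [← Real.exp_add]
        congr 1
        rw [hκdef]; push_cast; ring
      have h3 : Real.exp (2 * κ) ≤ 3 := by
        have : 2 * κ ≤ 1 := by rw [hκdef]; linarith
        calc Real.exp (2 * κ) ≤ Real.exp 1 := Real.exp_le_exp.mpr this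
          _ ≤ 3 := by have := Real.exp_one_lt_d9; linarith
      rw [h2]
      have h4 : 0 ≤ Real.exp (-((E₂ - E₀) / 384 * ((d' + 1 : ℕ) : ℝ))) * ∑ p, ‖ψ p‖ ^ 2 :=
        mul_nonneg (Real.exp_pos _).le hS0
      calc 100 * (Real.exp (2 * κ) * Real.exp (-((E₂ - E₀) / 384 * ((d' + 1 : ℕ) : ℝ)))) *
            ∑ p, ‖ψ p‖ ^ 2
          = (100 * Real.exp (2 * κ)) *
            (Real.exp (-((E₂ - E₀) / 384 * ((d' + 1 : ℕ) : ℝ))) * ∑ p, ‖ψ p‖ ^ 2) := by ring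
        _ ≤ 300 * (Real.exp (-((E₂ - E₀) / 384 * ((d' + 1 : ℕ) : ℝ))) * ∑ p, ‖ψ p‖ ^ 2) :=
            mul_le_mul_of_nonneg_right (by linarith) h4
        _ = _ := by ring

end WindowModes

end Summit.QuantumFields.QCD.Cruxes.ExtinctionBuildsQCD.BlockAwayTheSign

end
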